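import Mathlib
import Summits.ValiantsHypothesis.ValiantsHypothesis.Theorems.BarrierLeverPartitionMinorsHitByVPHiddenStatesFullJoinTrace

/-!
# Route BarrierLever — item `PartitionMinorsHitByVP` (stmt-ValiantsHypothesis-19717), line `hidden_states`:
# CUBE-CORE universal designs from the Sauer–Shelah lemma, and UTD-flat AT THE FIRST PAIR (`r = K + 2`) for EVERY row family

Helper file 2/2 (`--supports stmt-ValiantsHypothesis-19717`; cell valiant-natproofs, rung V4, 𝒟-side door (c), line
`Cruxes/PartitionMinorsHitByVP/Lines/hidden_states.lean` v9; prover seat val-np-p3 gen 17; mandate R26 (ii) of planner p1 g23: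
«UTD-flat — first the pair layer»). Two small `def`s naming ONE explicit design and its weights; closes NO item.

* `cubeCoreDesign m F` / `cubeCoreWt` — the CUBE-CORE design: all subsets of `m` core states plus `F` free singletons
  (`r = 2^m + F` members, `K = m + F` states); `cubeCoreDesign_injective`, `cubeCoreDesign_threshold` (a STRICT threshold family:
  core states weigh `1`, free states `m + 1`; members weigh `≤ m + 1`, non-members `≥ m + 2`). For `m = 2` this IS the flat colex
  design `S_flat(r)` on `K = r − 2` states (`∅`, all singletons, the first pair `{0,1}`); for `m = 0` the singleton design.
* `exists_table_cubeCore` (a shattered `m`-set realises the core; trace criterion of part 1) and **`cubeCore_universal`: for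
  `0 < h` and `Σ_{i<m} C(h,i) < 2^m + F` the cube-core design serves EVERY injective family of `2^m + F` subsets of `Fin h`**
  (Sauer–Shelah–Perles: such a family shatters an `m`-set); `universalThresholdDesign_body_cubeCore` = the body of
  `FullJoin.Stmt.universalThresholdDesign` at `(h, 2^m + F)` whenever also `m + F ≤ h³`.
* **`firstPair_universal` — UTD-flat at the first pair**: for `0 < h` and every `r = K + 2 ≥ h + 2`, the flat design on `K` states
  serves every injective row family of size `r` (memo val-np-p3 g16 §19 proved this on paper by the Hermite degeneration; the
  kernel content is «`r > h + 1 = C(h,0) + C(h,1)` ⇒ a shattered pair», VC dimension `≥ 2`, plus the trace criterion).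
  `universalThresholdDesign_body_of_le`: the node's body for every `1 ≤ r ≤ h³ + 2`, `h ≥ 2` (singletons up to `h³ + 1`, the flat
  first pair with `K = h³` at `r = h³ + 2`).

HONEST RANGE. A cube core buys `2^m` members at the price `r > Σ_{i<m} C(h,i) ≈ h^{m−1}/(m−1)!` (Sauer–Shelah is tight), so these
universal designs live in the polynomial range of `r`, where the ITEM is already unconditional (p680788); the exponential middle range of
the node is untouched. New is the METHOD — a trace / VC-dimension criterion with explicit `0/1/2` tables — and the first kernel theorem
in which a flat design with an affinely DEPENDENT member (`{0,1}`: `p_{01} = p_0 + p_1 − p_∅`) is universal for all row families.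
WHAT THIS IS NOT: not UTD / UTD-flat beyond `r = K + 2`; item 19717 stays OPEN; nothing on crux 14610 or VP ≠ VNP.
-/

set_option linter.dupNamespace false

namespace Summit.ValiantsHypothesis.ValiantsHypothesis.Theorems.BarrierLever.HiddenStates

open Finset Matrix

noncomputable section

namespace FullJoin

variable {h r K : ℕ}

/-! ## 5. CUBE-CORE designs: `2^[m]` on `m` core states plus `F` free singletons (`K = m + F`, `r = 2^m + F`) -/

/-- Cardinalities: `2^m + F = |2^[m] ⊔ [F]|`. -/
theorem cubeCore_card (m F : ℕ) :
    Fintype.card (Fin (2 ^ m + F)) = Fintype.card (Finset (Fin m) ⊕ Fin F) := by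
  simp [Fintype.card_sum, Fintype.card_finset]

/-- The indexing equivalence of the cube-core design (some fixed bijection `Fin (2^m + F) ≃ 2^[m] ⊔ [F]`). -/
def cubeCoreEquiv (m F : ℕ) : Fin (2 ^ m + F) ≃ (Finset (Fin m) ⊕ Fin F) :=
  Fintype.equivOfCardEq (cubeCore_card m F)

/-- **The cube-core design**: the members are all subsets of the `m` core states `{0,…,m−1}` and the `F` singletons
`{m + j}` of the free states. For `m = 2` this is exactly the FLAT COLEX design `S_flat(r)` on `K = r − 2` states
(`∅`, all `K` singletons, the first pair); for `m = 0` it is the singleton design. -/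
def cubeCoreDesign (m F : ℕ) (k : Fin (2 ^ m + F)) : Finset (Fin (m + F)) :=
  Sum.elim (fun S : Finset (Fin m) => S.map (Fin.castAddEmb F)) (fun j : Fin F => {Fin.natAdd m j})
    (cubeCoreEquiv m F k)

/-- The state weights making the cube-core design a strict threshold family: core states weigh `1`, free states `m + 1`. -/
def cubeCoreWt (m F : ℕ) (q : Fin (m + F)) : ℕ := if (q : ℕ) < m then 1 else m + 1

/-- The core states. -/
def cubeCoreStates (m F : ℕ) : Finset (Fin (m + F)) := (Finset.univ : Finset (Fin m)).map (Fin.castAddEmb F)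

/-- A state is a core state iff its index is `< m`. -/
theorem mem_cubeCoreStates {m F : ℕ} {q : Fin (m + F)} : q ∈ cubeCoreStates m F ↔ (q : ℕ) < m := by
  constructor
  · intro hq
    obtain ⟨j, _, rfl⟩ := Finset.mem_map.mp hq
    simp
  · intro hq
    exact Finset.mem_map.mpr ⟨⟨q, hq⟩, Finset.mem_univ _, by ext; simp⟩

/-- The members indexed through `inl S` are the core sets `S`. -/
theorem cubeCoreDesign_inl {m F : ℕ} {k : Fin (2 ^ m + F)} {S : Finset (Fin m)} (hk : cubeCoreEquiv m F k = Sum.inl S) :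
    cubeCoreDesign m F k = S.map (Fin.castAddEmb F) := by
  simp [cubeCoreDesign, hk]

/-- The members indexed through `inr j` are the free singletons `{m + j}`. -/
theorem cubeCoreDesign_inr {m F : ℕ} {k : Fin (2 ^ m + F)} {j : Fin F} (hk : cubeCoreEquiv m F k = Sum.inr j) :
    cubeCoreDesign m F k = {Fin.natAdd m j} := by
  simp [cubeCoreDesign, hk]

/-- The cube-core design is an injective family. -/
theorem cubeCoreDesign_injective (m F : ℕ) : Function.Injective (cubeCoreDesign m F) := by
  intro k k' hkk'
  apply (cubeCoreEquiv m F).injective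
  rcases hk : cubeCoreEquiv m F k with S | j <;> rcases hk' : cubeCoreEquiv m F k' with S' | j'
  · rw [cubeCoreDesign_inl hk, cubeCoreDesign_inl hk'] at hkk'
    rw [(Finset.map_injective (Fin.castAddEmb F)) hkk']
  · exfalso
    rw [cubeCoreDesign_inl hk, cubeCoreDesign_inr hk'] at hkk'
    have : Fin.natAdd m j' ∈ S.map (Fin.castAddEmb F) := by rw [hkk']; exact Finset.mem_singleton_self _
    obtain ⟨i, _, hi⟩ := Finset.mem_map.mp this
    have := congrArg Fin.val hi
    simp at this
    omega
  · exfalso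
    rw [cubeCoreDesign_inr hk, cubeCoreDesign_inl hk'] at hkk'
    have : Fin.natAdd m j ∈ S'.map (Fin.castAddEmb F) := by rw [← hkk']; exact Finset.mem_singleton_self _
    obtain ⟨i, _, hi⟩ := Finset.mem_map.mp this
    have := congrArg Fin.val hi
    simp at this
    omega
  · rw [cubeCoreDesign_inr hk, cubeCoreDesign_inr hk', Finset.singleton_inj] at hkk'
    have := congrArg Fin.val hkk'
    simp at this
    rw [Fin.ext this]

/-- A member lies inside the core states iff it is a core member. -/
theorem cubeCoreDesign_subset_core_iff {m F : ℕ} {k : Fin (2 ^ m + F)} :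
    cubeCoreDesign m F k ⊆ cubeCoreStates m F ↔ ∃ S, cubeCoreEquiv m F k = Sum.inl S := by
  rcases hk : cubeCoreEquiv m F k with S | j
  · simp only [cubeCoreDesign_inl hk, Sum.inl.injEq, exists_eq', iff_true]
    intro q hq
    obtain ⟨i, _, rfl⟩ := Finset.mem_map.mp hq
    exact mem_cubeCoreStates.mpr (by simp)
  · simp only [cubeCoreDesign_inr hk, reduceCtorEq, exists_false, iff_false, Finset.singleton_subset_iff,
      mem_cubeCoreStates, Fin.natAdd]
    omega

/-- Every subset of the core states is a member of the cube-core design. -/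
theorem cubeCoreDesign_surj_core {m F : ℕ} (I : Finset (Fin (m + F))) (hI : I ⊆ cubeCoreStates m F) :
    ∃ k, cubeCoreDesign m F k = I := by
  obtain ⟨S, _, rfl⟩ := Finset.subset_map_iff.mp hI
  refine ⟨(cubeCoreEquiv m F).symm (Sum.inl S), ?_⟩
  exact cubeCoreDesign_inl (by simp)

/-- **The cube-core design is a strict threshold family** for the weights `cubeCoreWt` (core `1`, free `m + 1`): every
member weighs at most `m + 1`, every non-member contains a free state and a second state, hence weighs at least `m + 2`. -/
theorem cubeCoreDesign_threshold (m F : ℕ) (J' : Finset (Fin (m + F))) (hJ' : J' ∉ Set.range (cubeCoreDesign m F))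
    (k : Fin (2 ^ m + F)) : ∑ q ∈ cubeCoreDesign m F k, cubeCoreWt m F q < ∑ q ∈ J', cubeCoreWt m F q := by
  -- member weight ≤ m + 1
  have hmem : ∑ q ∈ cubeCoreDesign m F k, cubeCoreWt m F q ≤ m + 1 := by
    rcases hk : cubeCoreEquiv m F k with S | j
    · rw [cubeCoreDesign_inl hk, Finset.sum_map]
      have : ∀ i ∈ S, cubeCoreWt m F (Fin.castAddEmb F i) = 1 := by
        intro i _; simp [cubeCoreWt]
      rw [Finset.sum_congr rfl this, Finset.sum_const, smul_eq_mul, mul_one]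
      exact (Finset.card_le_univ S).trans (by simp)
    · rw [cubeCoreDesign_inr hk, Finset.sum_singleton]
      simp [cubeCoreWt]
  -- a non-member has a free state and another state
  have hnc : ¬ J' ⊆ cubeCoreStates m F := fun hsub => by
    obtain ⟨k', hk'⟩ := cubeCoreDesign_surj_core J' hsub
    exact hJ' ⟨k', hk'⟩
  obtain ⟨q₀, hq₀J, hq₀⟩ := Finset.not_subset.mp hnc
  rw [mem_cubeCoreStates, not_lt] at hq₀
  have hne : J' ≠ {q₀} := by
    rintro rfl
    apply hJ'
    have hlt : (q₀ : ℕ) - m < F := by omega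
    refine ⟨(cubeCoreEquiv m F).symm (Sum.inr ⟨(q₀ : ℕ) - m, hlt⟩), ?_⟩
    rw [cubeCoreDesign_inr (j := ⟨(q₀ : ℕ) - m, hlt⟩) (by simp), Finset.singleton_inj]
    ext
    simp only [Fin.natAdd_mk]
    omega
  obtain ⟨q₁, hq₁J, hq₁⟩ : ∃ q₁ ∈ J', q₁ ≠ q₀ := by
    by_contra hall
    push Not at hall
    apply hne
    ext q
    simp only [Finset.mem_singleton]
    exact ⟨fun hq => hall q hq, fun hq => hq ▸ hq₀J⟩
  have h2 : cubeCoreWt m F q₀ + cubeCoreWt m F q₁ ≤ ∑ q ∈ J', cubeCoreWt m F q := by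
    rw [← Finset.sum_pair hq₁.symm]
    exact Finset.sum_le_sum_of_subset_of_nonneg (by
      intro q hq
      simp only [Finset.mem_insert, Finset.mem_singleton] at hq
      rcases hq with rfl | rfl <;> assumption) (fun _ _ _ => Nat.zero_le _)
  have hw0 : cubeCoreWt m F q₀ = m + 1 := by simp [cubeCoreWt]; omega
  have hw1 : 1 ≤ cubeCoreWt m F q₁ := by simp only [cubeCoreWt]; split_ifs <;> omega
  omega

/-- **CUBE-CORE UNISOLVENCE FROM A SHATTERED SET.** If the injective row family `u` (any `2^m + F` distinct subsets of
`Fin h`) SHATTERS some `m`-set `A`, the cube-core design admits a block-additive table with nonsingular design matrix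
(trace criterion: the core `2^[m]` is realised on `A`). -/
theorem exists_table_cubeCore {m F : ℕ} (hh : 0 < h) (u : Fin (2 ^ m + F) → Finset (Fin h)) (hu : Function.Injective u)
    (A : Finset (Fin h)) (hA : #A = m) (hsh : (Finset.univ.image u).Shatters A) :
    ∃ tx : Option (Fin (m + F)) → Fin h → ℂ,
      (Matrix.of fun i k : Fin (2 ^ m + F) =>
        ∏ a ∈ u i, (tx none a + ∑ q ∈ cubeCoreDesign m F k, tx (some q) a)).det ≠ 0 := by
  classical
  -- the core states are sent onto `A` in order
  set ι : Fin (m + F) → Fin h := fun q => if hq : (q : ℕ) < m then A.orderEmbOfFin hA ⟨q, hq⟩ else ⟨0, hh⟩ with hι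
  have hιcore : ∀ i : Fin m, ι (Fin.castAddEmb F i) = A.orderEmbOfFin hA i := by
    intro i
    simp only [hι, Fin.castAddEmb_apply, Fin.val_castAdd, Fin.is_lt, ↓reduceDIte, Fin.eta]
  have hinj : Set.InjOn ι (cubeCoreStates m F) := by
    intro q hq q' hq' hqq'
    obtain ⟨i, _, rfl⟩ := Finset.mem_map.mp (Finset.mem_coe.mp hq)
    obtain ⟨i', _, rfl⟩ := Finset.mem_map.mp (Finset.mem_coe.mp hq')
    rw [hιcore, hιcore] at hqq'
    rw [(A.orderEmbOfFin hA).injective hqq']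
  have himage_core : (cubeCoreStates m F).image ι = A := by
    rw [cubeCoreStates, Finset.map_eq_image, Finset.image_image]
    have : ι ∘ (Fin.castAddEmb F) = A.orderEmbOfFin hA := funext hιcore
    rw [this]
    -- range of orderEmbOfFin is A
    have h1 := Finset.image_orderEmbOfFin_univ A hA
    exact h1
  refine exists_table_of_core_trace u hu (cubeCoreDesign m F) (cubeCoreDesign_injective m F) (cubeCoreStates m F) ι
    hinj ?_ ?_ ?_
  · intro k hk
    rcases hk' : cubeCoreEquiv m F k with S | j
    · exact absurd (cubeCoreDesign_subset_core_iff.mpr ⟨S, hk'⟩) hk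
    · refine ⟨Fin.natAdd m j, ?_, cubeCoreDesign_inr hk'⟩
      rw [mem_cubeCoreStates]; simp
  · intro k hk I hI
    exact cubeCoreDesign_surj_core I (hI.trans hk)
  · intro k hk
    obtain ⟨S, hS⟩ := cubeCoreDesign_subset_core_iff.mp hk
    have hsubA : (cubeCoreDesign m F k).image ι ⊆ A := by
      rw [← himage_core]; exact Finset.image_subset_image hk
    obtain ⟨W, hW, hAW⟩ := hsh hsubA
    obtain ⟨i, _, rfl⟩ := Finset.mem_image.mp hW
    exact ⟨i, by rw [himage_core, Finset.inter_comm, hAW]⟩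

/-! ## 6. Universal statements: cube-core designs serve EVERY row family of their size once `r > Σ_{i<m} C(h,i)` -/

/-- **CUBE-CORE UNIVERSALITY (VC dimension ⇒ unisolvence).** For `0 < h` and `Σ_{i<m} C(h,i) < 2^m + F`, the cube-core
design on `K = m + F` states admits, for EVERY injective row family `u` of `2^m + F` subsets of `Fin h`, a block-additive
table with nonsingular design matrix: by the Sauer–Shelah–Perles lemma `u` shatters some `m`-set, on which the core is realised. -/
theorem cubeCore_universal {m F : ℕ} (hh : 0 < h) (hr : ∑ i ∈ Finset.range m, h.choose i < 2 ^ m + F)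
    (u : Fin (2 ^ m + F) → Finset (Fin h)) (hu : Function.Injective u) :
    ∃ tx : Option (Fin (m + F)) → Fin h → ℂ,
      (Matrix.of fun i k : Fin (2 ^ m + F) =>
        ∏ a ∈ u i, (tx none a + ∑ q ∈ cubeCoreDesign m F k, tx (some q) a)).det ≠ 0 := by
  obtain ⟨A, hA, hsh⟩ := exists_shatters_of_card_gt u hu m hr
  exact exists_table_cubeCore hh u hu A hA hsh

/-- **The body of the one-sided node `Stmt.universalThresholdDesign` at `(h, 2^m + F)`, by the cube-core design** — whenever
`Σ_{i<m} C(h,i) < 2^m + F` and the state budget `m + F ≤ h³` is met. -/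
theorem universalThresholdDesign_body_cubeCore {m F : ℕ} (hh : 0 < h)
    (hr : ∑ i ∈ Finset.range m, h.choose i < 2 ^ m + F) (hK : m + F ≤ h * h * h) :
    ∃ (K : ℕ) (J : Fin (2 ^ m + F) → Finset (Fin K)) (wt : Fin K → ℕ), K ≤ h * h * h ∧ Function.Injective J ∧
      (∀ J' : Finset (Fin K), J' ∉ Set.range J → ∀ k : Fin (2 ^ m + F), ∑ q ∈ J k, wt q < ∑ q ∈ J', wt q) ∧
      ∀ u : Fin (2 ^ m + F) → Finset (Fin h), Function.Injective u →
        ∃ tx : Option (Fin K) → Fin h → ℂ,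
          (Matrix.of fun i k : Fin (2 ^ m + F) => ∏ a ∈ u i, (tx none a + ∑ q ∈ J k, tx (some q) a)).det ≠ 0 :=
  ⟨m + F, cubeCoreDesign m F, cubeCoreWt m F, hK, cubeCoreDesign_injective m F, cubeCoreDesign_threshold m F,
    fun u hu => cubeCore_universal hh hr u hu⟩

/-- **UTD-flat AT THE FIRST PAIR (`r = K + 2`), for EVERY row family.** For `0 < h` and `h + 2 ≤ r = 4 + F`, the flat colex design
on `K = r − 2` states (`∅`, all `K` singletons, the pair of the two lightest states = the cube-core design with `m = 2`) admits a
nonsingular block-additive table against every injective family of `r` subsets of `Fin h`. (Paper version: memo val-np-p3 g16 §19,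
via the Hermite degeneration; here: a shattered PAIR exists as soon as `r > h + 1` — Sauer–Shelah with VC dimension `1` — and the
trace criterion.) -/
theorem firstPair_universal {F : ℕ} (hh : 0 < h) (hr : h + 2 ≤ 2 ^ 2 + F)
    (u : Fin (2 ^ 2 + F) → Finset (Fin h)) (hu : Function.Injective u) :
    ∃ tx : Option (Fin (2 + F)) → Fin h → ℂ,
      (Matrix.of fun i k : Fin (2 ^ 2 + F) =>
        ∏ a ∈ u i, (tx none a + ∑ q ∈ cubeCoreDesign 2 F k, tx (some q) a)).det ≠ 0 := by
  refine cubeCore_universal hh ?_ u hu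
  simp only [Finset.sum_range_succ, Finset.sum_range_zero, Nat.choose_zero_right, Nat.choose_one_right, zero_add]
  omega

/-- **The body of `Stmt.universalThresholdDesign` for every `1 ≤ r ≤ h³ + 2` (`h ≥ 2`)** — singletons (`m = 0`) up to `h³ + 1`,
the flat first pair (`m = 2`, `K = h³`) at `r = h³ + 2`. -/
theorem universalThresholdDesign_body_of_le (hh : 2 ≤ h) (hr1 : 1 ≤ r) (hr : r ≤ h * h * h + 2) :
    ∃ (K : ℕ) (J : Fin r → Finset (Fin K)) (wt : Fin K → ℕ), K ≤ h * h * h ∧ Function.Injective J ∧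
      (∀ J' : Finset (Fin K), J' ∉ Set.range J → ∀ k : Fin r, ∑ q ∈ J k, wt q < ∑ q ∈ J', wt q) ∧
      ∀ u : Fin r → Finset (Fin h), Function.Injective u →
        ∃ tx : Option (Fin K) → Fin h → ℂ,
          (Matrix.of fun i k : Fin r => ∏ a ∈ u i, (tx none a + ∑ q ∈ J k, tx (some q) a)).det ≠ 0 := by
  have hh0 : 0 < h := by omega
  by_cases hle : r ≤ h * h * h + 1
  · obtain ⟨F, rfl⟩ : ∃ F, r = 2 ^ 0 + F := ⟨r - 1, by omega⟩
    exact universalThresholdDesign_body_cubeCore (m := 0) hh0 (by simp) (by omega)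
  · have hreq : r = h * h * h + 2 := by omega
    have h4 : 4 ≤ r := by nlinarith
    obtain ⟨F, rfl⟩ : ∃ F, r = 2 ^ 2 + F := ⟨r - 4, by omega⟩
    refine universalThresholdDesign_body_cubeCore (m := 2) hh0 ?_ (by omega)
    simp only [Finset.sum_range_succ, Finset.sum_range_zero, Nat.choose_zero_right, Nat.choose_one_right, zero_add]
    nlinarith

end FullJoin

end

end Summit.ValiantsHypothesis.ValiantsHypothesis.Theorems.BarrierLever.HiddenStates
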